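/-
Copyright (c) 2026 the pub-hodgecm-mathlib formalisation cell (harness21).  Prover seat hodgecm-mathlib-K2E4-p07 (g3), Track B «K2-LIT» ∕ h413
(stmt-HodgeConjecture-24833), ‹S› ROAD J ∕ R3 «RANK-ONE MASS», brick R3g «BLOCK MODEL OF THE COMPACT SHEET» (K2E3-plan (g2) 01:04:01Z ∕ road owner K2E3-p15 (g2)
01:12:33Z → this seat).  2026-09-04.
-/
import Summits.HodgeConjecture.HodgeConjecture.Theorems.K2E3CompactSheetBlockModelKit   -- ★ p856451 (this seat): block change of basis, the global uniformizer `ξ = ϖ_v`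
import Literature.NumberTheory.Rogawski1990.LocalNormFibreDockBlockIsotropic          -- ★ B-p04: `not_exists_neg_det_badBlock_eq_norm` (the bad block is anisotropic)
import Literature.NumberTheory.Automorphic.LocalHermitianPlaneCongruence              -- ★ `exists_formCongr_eq_of_det_eq_mul_norm` (Jacobowitz, rank 2)
import Literature.NumberTheory.Automorphic.QuadraticLocalNormGroupNonsplit             -- ★ `exists_norm_mul_of_not_exists_norm` (local norm index two)
import Literature.NumberTheory.Automorphic.LocalUnitaryGroupCongr                     -- ★ `cmDatumLocalCongr`, `coe_cmDatumLocalCongr_apply`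
import Literature.NumberTheory.Automorphic.HeisenbergChartAtNonsplitPlace             -- ★ `valued_conjLocal_apply_of_smul_eq`
import Literature.NumberTheory.Automorphic.NonsplitPlaceHaarBallRatios                -- ★ `isUnit_toLocalRing_uniformizer`
import Literature.NumberTheory.Automorphic.LocalRegularOrbitClosed                    -- ★ `map_conjLocal_transpose_localForm`, `isUnit_det_localForm`
import Literature.NumberTheory.Rogawski1990.ExplicitFactorRationalLocalisation        -- ★ `adelicForm_map_adeleToLocal`
import Literature.NumberTheory.Automorphic.GodementHeightFloor                        -- ★ `Godement.det_ne_zero_of_anisotropic`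
import Literature.NumberTheory.Weil1982.UnitaryFinCentralizerTopFormHaar               -- ★ `UnitaryFinTopForm.mat`
import HarnessLib

/-!
# ‹S› road J ∕ R3 — R3g «BLOCK MODEL OF THE COMPACT SHEET»: the second class `ε′` of the κ-block sits, through a local form congruence, as a BLOCK-SCALAR point of
# `U(⟨1, −ξ⟩ ⊕ᶠ ⟨c_b⟩)(L⁺_v)` with GLOBAL blocks (Rogawski 1990 §3.8 Prop. 3.8.1 (a),(d) p. 30; §8.1 p. 116)

Cell `pub/hodgecm-mathlib`, Track B «K2-LIT», crux H413 = `stmt-HodgeConjecture-24833`; ‹S› ROAD J, letter ‹J3› (v2) `sig_K2E3CompatibleMeasureEPIdentityRankOne`, payer road R3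
«RANK-ONE MASS» (owner K2E3-p15 (g2)).  THEOREMS ONLY (no definition, no instance, no notation, no `sorry`); `--supports stmt-HodgeConjecture-24833 --as helper`.

THE THEOREM **`exists_blockModel_compactSheet`**.  At a finite place `v` of `L⁺` NON-SPLIT and UNRAMIFIED in `L` (`w ∣ v`, `c • w = w`), in the frame of ‹J3 v2› (the central
point `ε_H = (a·1₂, u)`, the central dock `θ : H_v ≃ₜ* Z(ε)` read in `GL₃` by `y`, the coordinate swap `W`, the dock frame `ᵗσ(yW)·H′_v·(yW) = G₁ ⊕ᶠ G₂`, the bad frame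
`ᵗσ(P′)·H′_v·P′ = G₁′ ⊕ᶠ G₂′` with `det G₁′ ∉ det G₁ · N(L_v^×)`, and a second class `ε′` framed by `P′`: `ε′·P′ = P′·(a·1₂ ⊕ᶠ u)`), there are GLOBAL `ξ, c_b ∈ L⁺` with
`|ξ|_w = exp(−1)` (`ξ = ϖ_v`, Mathlib's chosen uniformizer of `v`), `c_b ∈ {1, ξ}`, a local change of basis `T ∈ GL₃(L ⊗ L⁺_v)` with
`ᵗ(σT)·H′_v·T = (⟨1, −ξ⟩ ⊕ᶠ ⟨c_b⟩)_v` and a point `x ∈ U(⟨1,−ξ⟩ ⊕ᶠ ⟨c_b⟩)(L⁺_v)` with matrix `a·1₂ ⊕ᶠ u·1₁`, `a − u` a unit, carried by `φ_T` to `ε′` — EXACTLY the block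
model `(Ha, Hb, T, hT, x, hab, hx, hy)` consumed by ★ p856281 `K2E3CentralizerTamagawaPartnerBlockProduct.finTamagawaPartner_univ_eq_mul_of_blockModel` (K2E4-p13 (g2), (c3)),
with `Ha = !![1,0;0,−ξ]` the anisotropic unitary plane of K2E3-p15's R3b-3 (`|ξ|_w = exp(−1)`) and `Hb = !![c_b]` (R3e «U(1), any form»).

THE PROOF (all inputs ★).  (1) The bad block is ANISOTROPIC: `−det G₁′ ∉ N` (★ `not_exists_neg_det_badBlock_eq_norm`, from the dock: `−det G₁ ∈ N` and index two).
(2) `ϖ := ι_v(ϖ_v)` is a `σ`-fixed unit of `L ⊗ L⁺_v` which is NOT a norm (its order at `w` is `1`, a norm has even order — ★ `valued_conjLocal_apply_of_smul_eq`), so by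
index two (★ `exists_norm_mul_of_not_exists_norm`) `−det G₁′ = N(z)·ϖ`, i.e. `det ⟨1,−ξ⟩_v = −ϖ = det G₁′ · N(z⁻¹)`; Jacobowitz (★ `exists_formCongr_eq_of_det_eq_mul_norm`) gives
`S₁` with `ᵗσ(S₁) G₁′ S₁ = ⟨1, −ξ⟩_v`.  (3) The line: `g = (G₂′)₀₀` is a `σ`-fixed unit; either `g = N(z)` (then `c_b := 1`) or `g = N(z)·ϖ` (index two; `c_b := ξ`); `S₂ := (z⁻¹)`
gives `ᵗσ(S₂) G₂′ S₂ = ⟨c_b⟩_v`.  (4) `T := P′·(S₁ ⊕ᶠ S₂)` (★ kit `formCongr_mul_of_finSum`), `x := φ_T⁻¹ ε′`, whose matrix is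
`(S₁⊕S₂)⁻¹·P′⁻¹ε′P′·(S₁⊕S₂) = (S₁⊕S₂)⁻¹(a·1 ⊕ᶠ u)(S₁⊕S₂) = a·1 ⊕ᶠ u` (★ kit `finSum_inv_mul_scalar_mul`); `a − u ≠ 0` is a unit of the FIELD `L ⊗ L⁺_v = L_w`.

HONEST LABEL: HC_CM is proved only modulo the 7 printed citations (2 remaining named inputs: hLiu418 = stmt-HodgeConjecture-24832, h413 =
stmt-HodgeConjecture-24833) until rung 0 closes; this file is a count-neutral helper (local algebra + local class field theory of the unramified quadratic extension).

## References
* [Rogawski1990] J. D. Rogawski, *Automorphic Representations of Unitary Groups in Three Variables*, Ann. of Math. Stud. 123 (1990), §3.8 Prop. 3.8.1 (a),(d) p. 30; §8.1 p. 116.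
* [Jacobowitz1962] R. Jacobowitz, *Hermitian forms over local fields*, Amer. J. Math. 84 (1962), §3 Thm. 3.1 (classification by determinant class).
* [Omeara1963] O. T. O'Meara, *Introduction to Quadratic Forms* (1963), §63B Prop. 63:13, §63C Example 63:16 (local norm index two; units are norms).
* [PlatonovRapinchuk1994] V. Platonov, A. Rapinchuk, *Algebraic Groups and Number Theory* (1994), §2.3, §5.1.
-/

set_option autoImplicit false
set_option linter.dupNamespace false

noncomputable section

open NumberField IsDedekindDomain Matrix
open Literature.NumberTheory.Automorphic Literature.NumberTheory.Automorphic.UnitaryGroup Literature.NumberTheory.GaloisRepresentations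
open Literature.NumberTheory.Rogawski1990 Literature.NumberTheory.Weil1982.UnitaryFinTopForm
open Summit.HodgeConjecture.HodgeConjecture.Cruxes.H413.K2E3CompactSheetBlockModelKit
open scoped MatrixGroups

namespace Summit.HodgeConjecture.HodgeConjecture.Cruxes.H413.K2E3CompactSheetBlockModel

variable (L : Type) [Field L] [NumberField L] [IsCMField L] (H' : Matrix (Fin 3) (Fin 3) L)
  (hherm : (H'.map (cmConjRingHom L))ᵀ = H') (hanis : ∀ x : Fin 3 → L, Literature.AlgebraicGeometry.ShimuraVarieties.hermForm (cmConjRingHom L) H' x x = 0 → x = 0)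
  (v : HeightOneSpectrum (𝓞 ↥(maximalRealSubfield L))) (w : PlacesOver L v) (hw : IsCMField.complexConj L • w.1 = w.1)
  (hunr : Algebra.IsUnramifiedIn (𝓞 L) v.asIdeal)

/-! ## §1 Local lemmas: blocks of a frame, the uniformizer is not a norm, `1 × 1` congruences -/

section Local

/-- **Blocks of a frame of a hermitian form with unit determinant**: if `ᵗ(σP)·H·P = G₁ ⊕ᶠ G₂` (`P ∈ GL₃`) then `G₁` is `σ`-hermitian with unit determinant and
`g = (G₂)₀₀` is a `σ`-fixed unit. [cite: Rogawski1990, §3.8 p. 30] -/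
theorem blocks_of_twistGram_eq_finSum {R : Type*} [CommRing R] (σ : R →+* R) (hσ : ∀ r, σ (σ r) = r) {H : Matrix (Fin (2 + 1)) (Fin (2 + 1)) R}
    (hH : (H.map σ)ᵀ = H) (hHd : IsUnit H.det) (P : GL (Fin (2 + 1)) R) {G₁ : Matrix (Fin 2) (Fin 2) R} {G₂ : Matrix (Fin 1) (Fin 1) R}
    (hP : twistGram σ H P.val = finSum 2 1 G₁ G₂) :
    (G₁.map σ)ᵀ = G₁ ∧ σ (G₂ 0 0) = G₂ 0 0 ∧ IsUnit G₁.det ∧ IsUnit (G₂ 0 0) := by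
  have hGh : ((finSum 2 1 G₁ G₂).map σ)ᵀ = finSum 2 1 G₁ G₂ := by rw [← hP]; exact conjTranspose_twistGram σ H hσ hH P.val
  rw [transpose_finSum_map, finSum_inj] at hGh
  have hdets : IsUnit (G₁.det * G₂ 0 0) := by
    have h := congrArg Matrix.det hP
    rw [det_twistGram, det_finSum, Matrix.det_fin_one] at h
    rw [← h]
    exact (((Matrix.isUnits_det_units P).map σ).mul hHd).mul (Matrix.isUnits_det_units P)
  refine ⟨hGh.1, ?_, isUnit_of_mul_isUnit_left hdets, isUnit_of_mul_isUnit_right hdets⟩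
  have h := congrFun (congrFun hGh.2 0) 0
  simpa [Matrix.transpose_apply, Matrix.map_apply] using h

include hw hunr in
/-- **The uniformizer `ϖ = ι_v(ϖ_v)` is NOT a norm** at an unramified non-split place: a norm `σ(z)·z` has EVEN order at `w` (`σ_w` is an isometry, ★
`valued_conjLocal_apply_of_smul_eq`), while `|ϖ|_w = exp(−1)`. [cite: Omeara1963, §63C Example 63:16] [cite: NeukirchANT1999, Ch. II §6] -/
theorem not_exists_uniformizer_eq_norm :
    ¬ ∃ z : LocalRing L v, IsUnit z ∧
      toLocalRing L v (HeckeCharacter.uniformizer ↥(maximalRealSubfield L) v : v.adicCompletion ↥(maximalRealSubfield L)) =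
        conjLocal L (IsCMField.complexConj L) v z * z := by
  rintro ⟨z, -, hz⟩
  have hval := congrArg (fun t : LocalRing L v => Valued.v (t w)) hz
  simp only [toLocalRing_apply, Pi.mul_apply, map_mul] at hval
  rw [valued_toPlace_uniformizer L v w hunr, valued_conjLocal_apply_of_smul_eq L v w hw z] at hval
  -- `exp(−1) = |z_w|²` is impossible
  by_cases hz0 : Valued.v (z w) = 0
  · rw [hz0, mul_zero] at hval
    exact WithZero.coe_ne_zero hval
  · obtain ⟨n, hn⟩ : ∃ n : ℤ, Valued.v (z w) = WithZero.exp n := ⟨_, (WithZero.exp_log hz0).symm⟩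
    rw [hn, ← WithZero.exp_add] at hval
    have h := WithZero.exp_injective hval
    omega

/-- **A `1 × 1` congruence**: for a unit `s`, the unit matrix `(s)` carries `(g)` to `(σ(s)·g·s)`. [cite: PlatonovRapinchuk1994, §2.3] -/
theorem exists_gl_one_formCongr_eq {R : Type*} [CommRing R] (σ : R →+* R) {s : R} (hs : IsUnit s) (G₂ : Matrix (Fin 1) (Fin 1) R) :
    ∃ S₂ : GL (Fin 1) R, S₂.val = !![s] ∧ formCongr σ S₂ G₂ = !![σ s * G₂ 0 0 * s] := by
  obtain ⟨su, rfl⟩ := hs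
  refine ⟨⟨!![(su : R)], !![((su⁻¹ : Rˣ) : R)], ?_, ?_⟩, rfl, ?_⟩
  · ext i j; fin_cases i; fin_cases j; simp
  · ext i j; fin_cases i; fin_cases j; simp
  · ext i j
    fin_cases i; fin_cases j
    simp [formCongr, Matrix.mul_apply]

end Local

/-! ## §2 The block model of the compact sheet -/

include hherm hanis hw hunr in
set_option maxHeartbeats 1600000 in
/-- **R3g «BLOCK MODEL OF THE COMPACT SHEET».**  See the module docstring: from the ‹J3 v2› frame (central point, dock `θ` with its `GL₃`-reading `y`, swap `W`, dock frame
`(G₁, G₂)`, bad frame `(P′, G₁′, G₂′)` with `det G₁′ ∉ det G₁ · N`, second class `ε′` framed by `P′`) at an unramified non-split `v`: GLOBAL `ξ = ϖ_v, c_b ∈ {1, ξ} ⊂ L⁺`, a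
congruence `T` with `ᵗ(σT) H′_v T = (!![1,0;0,−ξ] ⊕ᶠ !![c_b])_v`, and the block-scalar preimage `x = φ_T⁻¹ ε′` — the hypotheses `(Ha, Hb, T, hT, x, hab, hx, hy)` of ★
`finTamagawaPartner_univ_eq_mul_of_blockModel`. [cite: Rogawski1990, §3.8 Prop. 3.8.1 (a),(d) p. 30; §8.1 p. 116] [cite: Jacobowitz1962, §3 Thm. 3.1]
[cite: Omeara1963, §63B Prop. 63:13, §63C Example 63:16] -/
theorem exists_blockModel_compactSheet
    (εH : ((cmDatum L 2 (Matrix.of fun i j : Fin 2 => if i.val + j.val + 1 = 2 then (1 : L) else 0)).Local v ×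
      (cmDatum L 1 (Matrix.of fun i j : Fin 1 => if i.val + j.val + 1 = 1 then (1 : L) else 0)).Local v)) (a : LocalRing L v)
    (hu : (εH.2.val.val : Matrix (Fin 1) (Fin 1) (LocalRing L v)) 0 0 ≠ a)
    {ε : (cmDatum L 3 H').Local v} {y : GL (Fin 3) (LocalRing L v)}
    (θ : ((cmDatum L 2 (Matrix.of fun i j : Fin 2 => if i.val + j.val + 1 = 2 then (1 : L) else 0)).Local v ×
      (cmDatum L 1 (Matrix.of fun i j : Fin 1 => if i.val + j.val + 1 = 1 then (1 : L) else 0)).Local v) ≃ₜ* ↥(Subgroup.centralizer ({ε} : Set ((cmDatum L 3 H').Local v))))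
    (hθ : ∀ z : ((cmDatum L 2 (Matrix.of fun i j : Fin 2 => if i.val + j.val + 1 = 2 then (1 : L) else 0)).Local v ×
      (cmDatum L 1 (Matrix.of fun i j : Fin 1 => if i.val + j.val + 1 = 1 then (1 : L) else 0)).Local v),
      (((θ z).1).val : GL (Fin 3) (LocalRing L v)) = y * ((endoEmbLocal L v z).val : GL (Fin 3) (LocalRing L v)) * y⁻¹)
    {W : GL (Fin 3) (LocalRing L v)} (hW : W.val = !![(1 : LocalRing L v), 0, 0; 0, 0, 1; 0, 1, 0])
    {G₁ G₁' : Matrix (Fin 2) (Fin 2) (LocalRing L v)} {G₂ G₂' : Matrix (Fin 1) (Fin 1) (LocalRing L v)} (P' : GL (Fin (2 + 1)) (LocalRing L v))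
    (hPW : twistGram (conjLocal L (IsCMField.complexConj L) v) ((adelicForm L 3 H').map (adeleToLocal L v)) (y * W).val = finSum 2 1 G₁ G₂)
    (hP' : twistGram (conjLocal L (IsCMField.complexConj L) v) ((adelicForm L 3 H').map (adeleToLocal L v)) P'.val = finSum 2 1 G₁' G₂')
    (hnn : ¬ ∃ z : LocalRing L v, IsUnit z ∧ G₁'.det = G₁.det * (conjLocal L (IsCMField.complexConj L) v z * z))
    (ε' : (cmDatum L 3 H').Local v)
    (hε' : (ε'.val.val : Matrix (Fin 3) (Fin 3) (LocalRing L v)) * P'.val =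
      P'.val * finSum 2 1 (a • (1 : Matrix (Fin 2) (Fin 2) (LocalRing L v))) (εH.2.val.val : Matrix (Fin 1) (Fin 1) (LocalRing L v))) :
    ∃ (ξ cb : L), IsCMField.complexConj L ξ = ξ ∧ IsCMField.complexConj L cb = cb ∧
      Valued.v (algebraMap L (w.1.adicCompletion L) ξ) = WithZero.exp (-1 : ℤ) ∧ cb ≠ 0 ∧ (cb = 1 ∨ cb = ξ) ∧
      ∃ (T : GL (Fin (2 + 1)) (LocalRing L v))
        (hT : formCongr (conjLocal L (IsCMField.complexConj L) v) T (H'.map (algebraMap L (LocalRing L v))) =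
          (1 : LocalRing L v) • (finSum 2 1 !![(1 : L), 0; 0, -ξ] !![cb]).map (algebraMap L (LocalRing L v)))
        (x : (cmDatum L (2 + 1) (finSum 2 1 !![(1 : L), 0; 0, -ξ] !![cb])).Local v),
        IsUnit (a - (εH.2.val.val : Matrix (Fin 1) (Fin 1) (LocalRing L v)) 0 0) ∧
        mat L (2 + 1) (finSum 2 1 !![(1 : L), 0; 0, -ξ] !![cb]) v x =
          finSum 2 1 (a • (1 : Matrix (Fin 2) (Fin 2) (LocalRing L v))) (((εH.2.val.val : Matrix (Fin 1) (Fin 1) (LocalRing L v)) 0 0) • (1 : Matrix (Fin 1) (Fin 1) (LocalRing L v))) ∧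
        cmDatumLocalCongr L v T isUnit_one hT x = ε' := by
  classical
  -- (0) the field `L ⊗ L⁺_v = L_w`, its involution `σ`, an anti-fixed `δ`
  set σ := conjLocal L (IsCMField.complexConj L) v with hσdef
  have hF : IsField (LocalRing L v) := LocalRing.isField_of_smul_eq (IsCMField.complexConj L) (IsCMField.complexConj_ne_one L) w hw
  obtain ⟨x₀, hx₀⟩ := Literature.NumberTheory.NumberFields.IsCMField.exists_complexConj_ne L
  set δ : L := x₀ - IsCMField.complexConj L x₀ with hδdef
  have hcδ : IsCMField.complexConj L δ = -δ := by rw [hδdef, map_sub, IsCMField.complexConj_apply_apply, neg_sub]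
  have hδ : δ ≠ 0 := fun h => hx₀ (sub_eq_zero.1 h).symm
  have hσσ : ∀ s, σ (σ s) = s := Liu2021.LemD1OfPlace.conjLocal_conjLocal_apply L v (IsCMField.complexConj L) hcδ hδ
  have hdet' : H'.det ≠ 0 := Godement.det_ne_zero_of_anisotropic L H' hanis
  have hHv : (((adelicForm L 3 H').map (adeleToLocal L v)).map σ)ᵀ = (adelicForm L 3 H').map (adeleToLocal L v) :=
    map_conjLocal_transpose_localForm L 3 H' v hherm
  have hHvd : IsUnit ((adelicForm L 3 H').map (adeleToLocal L v)).det := UnitaryGroup.isUnit_det_localForm L 3 H' v hdet'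
  have hunit_of_ne : ∀ {t : LocalRing L v}, t ≠ 0 → IsUnit t := fun {t} ht => by
    obtain ⟨s, hs⟩ := hF.mul_inv_cancel ht
    exact isUnit_iff_exists_inv.2 ⟨s, hs⟩
  -- (1) blocks of the bad frame
  obtain ⟨hG₁'h, hgσ, hG₁'d, hgu⟩ := blocks_of_twistGram_eq_finSum σ hσσ hHv hHvd P' hP'
  -- (2) the bad block is anisotropic, the uniformizer is not a norm, index two
  have hbad := not_exists_neg_det_badBlock_eq_norm L H' v w hw hherm hdet' θ hθ hW hPW hnn
  set ϖ : LocalRing L v := toLocalRing L v (HeckeCharacter.uniformizer ↥(maximalRealSubfield L) v : v.adicCompletion ↥(maximalRealSubfield L)) with hϖdef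
  have hϖu : IsUnit ϖ := isUnit_toLocalRing_uniformizer L v
  have hϖσ : σ ϖ = ϖ := by rw [hσdef, hϖdef, conjLocal_toLocalRing]
  have hϖnn := not_exists_uniformizer_eq_norm L v w hw hunr
  obtain ⟨ξ, hξc, hξloc, hξv, -⟩ := exists_global_uniformizer L v w hunr
  have hdetσ : σ (-G₁'.det) = -G₁'.det := by
    rw [map_neg]
    congr 1
    have h := congrArg Matrix.det hG₁'h
    rwa [Matrix.det_transpose, ← RingHom.mapMatrix_apply, ← RingHom.map_det] at h
  obtain ⟨z₁, hz₁u, hz₁⟩ := exists_norm_mul_of_not_exists_norm L v (IsCMField.complexConj L) hcδ hδ w hw hϖσ hϖu hdetσ hG₁'d.neg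
    (fun ⟨z, hz, h⟩ => hϖnn ⟨z, hz, h⟩) (fun ⟨z, hz, h⟩ => hbad ⟨z, hz, h⟩)
  -- (3) the plane congruence `ᵗσ(S₁) G₁′ S₁ = ⟨1, −ξ⟩_v`
  have hHa : (!![(1 : L), 0; 0, -ξ]).map (algebraMap L (LocalRing L v)) = !![(1 : LocalRing L v), 0; 0, -ϖ] := by
    rw [hϖdef, ← hξloc]
    ext i j; fin_cases i <;> fin_cases j <;> simp
  have hHah : ((!![(1 : LocalRing L v), 0; 0, -ϖ]).map σ)ᵀ = !![(1 : LocalRing L v), 0; 0, -ϖ] := by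
    ext i j; fin_cases i <;> fin_cases j <;> simp [hϖσ]
  have hHad : IsUnit (!![(1 : LocalRing L v), 0; 0, -ϖ]).det := by
    rw [Matrix.det_fin_two_of]; simpa using hϖu.neg
  have hdet : ∃ z : LocalRing L v, IsUnit z ∧ (!![(1 : LocalRing L v), 0; 0, -ϖ]).det = G₁'.det * (σ z * z) := by
    refine ⟨↑(hz₁u.unit⁻¹), (hz₁u.unit⁻¹).isUnit, ?_⟩
    rw [Matrix.det_fin_two_of]
    have h3 : z₁ * ↑(hz₁u.unit⁻¹) = 1 := hz₁u.mul_val_inv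
    have h4 : σ z₁ * σ ↑(hz₁u.unit⁻¹) = 1 := by rw [← map_mul, h3, map_one]
    -- `−ϖ = det G₁′ · N(z₁⁻¹)` from `−det G₁′ = N(z₁) ϖ`
    have key : G₁'.det = -(σ z₁ * z₁ * ϖ) := by rw [← hz₁, neg_neg]
    rw [key]
    have e : -(σ z₁ * z₁ * ϖ) * (σ ↑(hz₁u.unit⁻¹) * ↑(hz₁u.unit⁻¹)) = -ϖ * ((σ z₁ * σ ↑(hz₁u.unit⁻¹)) * (z₁ * ↑(hz₁u.unit⁻¹))) := by ring
    rw [e, h3, h4]; simp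
  obtain ⟨S₁, hS₁⟩ := exists_formCongr_eq_of_det_eq_mul_norm L v (IsCMField.complexConj L) hcδ hδ w hw hG₁'h hHah hG₁'d hHad hdet
  -- (4) the line: `g = (G₂′)₀₀`, `c_b ∈ {1, ξ}`
  set g : LocalRing L v := G₂' 0 0 with hgdef
  obtain ⟨s, cb, hsu, hcbc, hcb0, hcb1ξ, hcbloc⟩ : ∃ (s : LocalRing L v) (cb : L), IsUnit s ∧ IsCMField.complexConj L cb = cb ∧ cb ≠ 0 ∧ (cb = 1 ∨ cb = ξ) ∧
      algebraMap L (LocalRing L v) cb = σ s * g * s := by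
    by_cases hg : ∃ z : LocalRing L v, IsUnit z ∧ g = σ z * z
    · obtain ⟨z, hzu, hz⟩ := hg
      refine ⟨↑(hzu.unit⁻¹), 1, (hzu.unit⁻¹).isUnit, map_one _, one_ne_zero, Or.inl rfl, ?_⟩
      have h3 : z * ↑(hzu.unit⁻¹) = 1 := hzu.mul_val_inv
      have h4 : σ z * σ ↑(hzu.unit⁻¹) = 1 := by rw [← map_mul, h3, map_one]
      rw [map_one, hz]
      have e : σ ↑(hzu.unit⁻¹) * (σ z * z) * ↑(hzu.unit⁻¹) = (σ z * σ ↑(hzu.unit⁻¹)) * (z * ↑(hzu.unit⁻¹)) := by ring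
      rw [e, h3, h4, mul_one]
    · obtain ⟨z, hzu, hz⟩ := exists_norm_mul_of_not_exists_norm L v (IsCMField.complexConj L) hcδ hδ w hw hϖσ hϖu hgσ hgu
        (fun ⟨z, hz, h⟩ => hϖnn ⟨z, hz, h⟩) hg
      have hξ0 : ξ ≠ 0 := by
        intro h0; rw [h0, map_zero, map_zero] at hξv; exact WithZero.zero_ne_coe hξv
      refine ⟨↑(hzu.unit⁻¹), ξ, (hzu.unit⁻¹).isUnit, hξc, hξ0, Or.inr rfl, ?_⟩
      have h3 : z * ↑(hzu.unit⁻¹) = 1 := hzu.mul_val_inv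
      have h4 : σ z * σ ↑(hzu.unit⁻¹) = 1 := by rw [← map_mul, h3, map_one]
      rw [hξloc, ← hϖdef, hz]
      have e : σ ↑(hzu.unit⁻¹) * (σ z * z * ϖ) * ↑(hzu.unit⁻¹) = ϖ * ((σ z * σ ↑(hzu.unit⁻¹)) * (z * ↑(hzu.unit⁻¹))) := by ring
      rw [e, h3, h4, mul_one, mul_one]
  obtain ⟨S₂, hS₂v, hS₂⟩ := exists_gl_one_formCongr_eq σ hsu G₂'
  have hHb : (!![cb]).map (algebraMap L (LocalRing L v)) = formCongr σ S₂ G₂' := by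
    rw [hS₂, ← hcbloc]
    ext i j; fin_cases i; fin_cases j; simp
  -- (5) the congruence `T = P′ · (S₁ ⊕ᶠ S₂)`
  obtain ⟨S, hS, hSi⟩ := exists_gl_val_eq_finSum S₁ S₂
  have hP'f : formCongr σ P' (H'.map (algebraMap L (LocalRing L v))) = finSum 2 1 G₁' G₂' := by
    rw [← Literature.NumberTheory.Rogawski1990.adelicForm_map_adeleToLocal L v H']; exact hP'
  have hT : formCongr σ (P' * S) (H'.map (algebraMap L (LocalRing L v))) =
      (1 : LocalRing L v) • (finSum 2 1 !![(1 : L), 0; 0, -ξ] !![cb]).map (algebraMap L (LocalRing L v)) := by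
    rw [one_smul, finSum_map, formCongr_mul_of_finSum σ _ P' S S₁ S₂ hP'f hS, hS₁, hHa, hHb]
  -- (6) the block-scalar preimage `x = φ_T⁻¹ ε′`
  set φ := cmDatumLocalCongr L v (P' * S) isUnit_one hT with hφdef
  refine ⟨ξ, cb, hξc, hcbc, hξv, hcb0, hcb1ξ, P' * S, hT, φ.symm ε', hunit_of_ne (sub_ne_zero.2 hu.symm), ?_, φ.apply_symm_apply ε'⟩
  -- the matrix of `x`: `(P′S)·mat x·(P′S)⁻¹ = ε′`
  have hconj : (P' * S) * (φ.symm ε').val * (P' * S)⁻¹ = ε'.val := by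
    rw [← coe_cmDatumLocalCongr_apply L v (P' * S) isUnit_one hT (φ.symm ε')]
    exact congrArg Subtype.val (φ.apply_symm_apply ε')
  have hx1 : (φ.symm ε').val = S⁻¹ * (P'⁻¹ * ε'.val * P') * S := by
    rw [← hconj]; group
  have hPε : (P'⁻¹).val * (ε'.val.val : Matrix (Fin 3) (Fin 3) (LocalRing L v)) * P'.val =
      finSum 2 1 (a • (1 : Matrix (Fin 2) (Fin 2) (LocalRing L v))) (εH.2.val.val : Matrix (Fin 1) (Fin 1) (LocalRing L v)) := by
    rw [Matrix.mul_assoc, hε', ← Matrix.mul_assoc, ← Units.val_mul, inv_mul_cancel, Units.val_one, Matrix.one_mul]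
  have hx2 : ((P'⁻¹ * ε'.val * P' : GL (Fin (2 + 1)) (LocalRing L v)).val : Matrix (Fin (2 + 1)) (Fin (2 + 1)) (LocalRing L v)) =
      finSum 2 1 (a • (1 : Matrix (Fin 2) (Fin 2) (LocalRing L v))) (εH.2.val.val : Matrix (Fin 1) (Fin 1) (LocalRing L v)) := by
    rw [Units.val_mul, Units.val_mul]; exact hPε
  rw [mat_def, hx1, Units.val_mul, Units.val_mul, hx2, finSum_inv_mul_scalar_mul S S₁ S₂ hS hSi, ← fin_one_eq_smul_one]

end Summit.HodgeConjecture.HodgeConjecture.Cruxes.H413.K2E3CompactSheetBlockModel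

end
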